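import Literature.NumberTheory.Rogawski1990.ArchCentralLimitFunctionalSymmetry   -- ★ p842255 (N7): ray rules, `rhoWeylDelta_comp_perm`, `sign_cast_mul_self`, `tendsto_comp_perm_nhdsWithin_injective`
import HarnessLib

/-!
# `S₃`-EQUIVARIANCE OF THE 8-RAY (Ω) FUNCTIONAL OF THE (L_{U(2,1)}) LETTER and its collapse lemma (Rogawski 1990 §8.4 p. 126: «`ω` is skew-symmetric, as is `ρ(γ)Δ(γ)` …
# the value of `ω[ρΔΦ^{st}]` at `γ₀` is `3c_G f(γ₀)`»)

Topic `NumberTheory/Rogawski1990`; namespace `Literature.NumberTheory.Rogawski1990`.  THEOREMS ONLY (no `def`, no instance, no notation, no axiom, no named fact, no `sorry`);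
pure torus-side bookkeeping.  Cell `pub/hodgecm-mathlib`, ENGINE T1 (crux H413 = `stmt-HodgeConjecture-24833`); ROAD-Sd residual R4, SdArch ED. 3 node **N7-bis** (F0P3a-p03 (g11)'s
design census 7141d221, (q1) 2026-09-01T07:30:07Z: «the letter's `Λ` IS the 8-ray form — cut N7 for THESE tokens»); author F0P3a-p06 (g11).  Twin of ★ p842255 (3-ray form).

THE 8-RAY FUNCTIONAL (the letter ★ p842205 `ArchCentralLimitFormulaRankTwo`, F0P3a-p02 (g11), VERBATIM token shape): for `G : (Fin 3 → Circle) → ℂ`,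
`Λ₈G(z) := (1∕48) · Σ_{ε : Fin 3 → Bool} (s₀s₁s₂) · T_{V_ε}G(z)`, `s_i := if ε i then 1 else −1`, `V_ε := ![s₀+s₁, −s₀+s₂, −s₁−s₂] = s₀(e₀−e₁) + s₁(e₀−e₂) + s₂(e₁−e₂)`,
`T_uG(z) := iteratedDeriv 3 (fun s => G (fun k => z k * Circle.exp (s * u k))) 0` (`= ((∂₀−∂₁)(∂₀−∂₂)(∂₁−∂₂)G)(z)` for `G` smooth near `z`: `Σ_ε ε₁ε₂ε₃(Σ_a ε_a ℓ_a)³ = 48ℓ₁ℓ₂ℓ₃`).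

WHAT IS PROVED.
* §1 (abstract) `lambda8_comp_perm_of_rule`: ANY line cube `T` with the transport rule `T_u(G∘σ)(z) = T_{u∘σ}G(z∘σ)` makes `Λ₈` ALTERNATING: `Λ₈(G∘(·∘σ))(z) = sign σ · Λ₈G(z∘σ)`.  (No
  oddness rule is needed here: a transposition permutes the SIGNED ray family `{V_ε}` through an involution `ε ↦ ε′` of `Fin 3 → Bool` with `s′₀s′₁s′₂ = −s₀s₁s₂` —
  `(0 1): ε′ = (¬ε₀, ε₂, ε₁)`, `(1 2): ε′ = (ε₁, ε₀, ¬ε₂)`, `(0 2): ε′ = (¬ε₂, ¬ε₁, ¬ε₀)` — then swap induction.)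
* §2 for the genuine `T_u` (rule = ★ `iteratedDeriv_ray_comp_perm`, `rfl`): **`lambda8_iteratedDeriv_comp_perm`** (every `G`, no smoothness), `lambda8_iteratedDeriv_const_mul`.
* §3 THE COLLAPSE LEMMA in the letter's shape: **`lambda8_rhoWeylDelta_mul_comp_perm`** `Λ₈[z′ ↦ ρ′Δ(z′)·Φ(z′∘σ)](z) = Λ₈[ρ′Δ·Φ](z∘σ)` (EXACT; `ρ′Δ` skew ★ `rhoWeylDelta_comp_perm`,
  `(sign σ)² = 1`) and **`tendsto_lambda8_rhoWeylDelta_mul_comp_perm`**: if `Λ₈[ρ′Δ·Φ] → ℓ` along `𝓝[{z | Injective z}] (ζ,ζ,ζ)` then so does `Λ₈[z′ ↦ ρ′Δ(z′)·Φ(z′∘σ)]` — each class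
  `diag(z∘σ)` of the (unsigned, (14.2.1)) stable class contributes the SAME constant: the rank-2 descent (N5) collapses `Σ_σ` to `Card · (−c·I)` per place (`3c_G` on `U(2,1)`, p. 126).
HONEST LABEL: HC_CM is proved only modulo the printed citations until rung 0 closes; this file is bookkeeping for R4's assembly and pays nothing by itself.

## References
* [Rogawski1990] J. D. Rogawski, *Automorphic Representations of Unitary Groups in Three Variables*, Ann. of Math. Stud. 123 (1990), §8.4 p. 126, §14.2 (14.2.1) p. 227.
-/

set_option autoImplicit false

noncomputable section

open Filter Topology Complex

namespace Literature.NumberTheory.Rogawski1990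

/-! ## §1 Abstract alternation of the 8-ray functional from the transport rule -/

section Abstract

variable {X : Type*}

/-- `(if ¬b then 1 else −1) = −(if b then 1 else −1)`. [cite: Rogawski1990, §8.4 p. 126] -/
theorem ite_not_one_neg_one (b : Bool) : (if (!b) = true then (1 : ℝ) else -1) = -(if b = true then (1 : ℝ) else -1) := by
  cases b <;> simp

/-- The signed ray `V_ε = ![s₀+s₁, −s₀+s₂, −s₁−s₂]` under the transposition `(0 1)`: `V_ε ∘ (0 1) = V_{ε′}`, `ε′ = (¬ε₀, ε₂, ε₁)`. [cite: Rogawski1990, §8.4 p. 126] -/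
theorem signedRay_comp_swap_zero_one (ε : Fin 3 → Bool) :
    (![(if ε 0 then (1 : ℝ) else -1) + (if ε 1 then (1 : ℝ) else -1), -(if ε 0 then (1 : ℝ) else -1) + (if ε 2 then (1 : ℝ) else -1),
        -(if ε 1 then (1 : ℝ) else -1) - (if ε 2 then (1 : ℝ) else -1)] ∘ (Equiv.swap (0 : Fin 3) 1)) =
      ![(if (![!(ε 0), ε 2, ε 1] : Fin 3 → Bool) 0 then (1 : ℝ) else -1) + (if (![!(ε 0), ε 2, ε 1] : Fin 3 → Bool) 1 then (1 : ℝ) else -1),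
        -(if (![!(ε 0), ε 2, ε 1] : Fin 3 → Bool) 0 then (1 : ℝ) else -1) + (if (![!(ε 0), ε 2, ε 1] : Fin 3 → Bool) 2 then (1 : ℝ) else -1),
        -(if (![!(ε 0), ε 2, ε 1] : Fin 3 → Bool) 1 then (1 : ℝ) else -1) - (if (![!(ε 0), ε 2, ε 1] : Fin 3 → Bool) 2 then (1 : ℝ) else -1)] := by
  funext k
  fin_cases k <;> cases ε 0 <;> simp [Equiv.swap_apply_of_ne_of_ne] <;> ring

/-- The signed ray under `(1 2)`: `V_ε ∘ (1 2) = V_{ε′}`, `ε′ = (ε₁, ε₀, ¬ε₂)`. [cite: Rogawski1990, §8.4 p. 126] -/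
theorem signedRay_comp_swap_one_two (ε : Fin 3 → Bool) :
    (![(if ε 0 then (1 : ℝ) else -1) + (if ε 1 then (1 : ℝ) else -1), -(if ε 0 then (1 : ℝ) else -1) + (if ε 2 then (1 : ℝ) else -1),
        -(if ε 1 then (1 : ℝ) else -1) - (if ε 2 then (1 : ℝ) else -1)] ∘ (Equiv.swap (1 : Fin 3) 2)) =
      ![(if (![ε 1, ε 0, !(ε 2)] : Fin 3 → Bool) 0 then (1 : ℝ) else -1) + (if (![ε 1, ε 0, !(ε 2)] : Fin 3 → Bool) 1 then (1 : ℝ) else -1),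
        -(if (![ε 1, ε 0, !(ε 2)] : Fin 3 → Bool) 0 then (1 : ℝ) else -1) + (if (![ε 1, ε 0, !(ε 2)] : Fin 3 → Bool) 2 then (1 : ℝ) else -1),
        -(if (![ε 1, ε 0, !(ε 2)] : Fin 3 → Bool) 1 then (1 : ℝ) else -1) - (if (![ε 1, ε 0, !(ε 2)] : Fin 3 → Bool) 2 then (1 : ℝ) else -1)] := by
  funext k
  fin_cases k <;> cases ε 2 <;> simp [Equiv.swap_apply_of_ne_of_ne] <;> ring

/-- The signed ray under `(0 2)`: `V_ε ∘ (0 2) = V_{ε′}`, `ε′ = (¬ε₂, ¬ε₁, ¬ε₀)`. [cite: Rogawski1990, §8.4 p. 126] -/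
theorem signedRay_comp_swap_zero_two (ε : Fin 3 → Bool) :
    (![(if ε 0 then (1 : ℝ) else -1) + (if ε 1 then (1 : ℝ) else -1), -(if ε 0 then (1 : ℝ) else -1) + (if ε 2 then (1 : ℝ) else -1),
        -(if ε 1 then (1 : ℝ) else -1) - (if ε 2 then (1 : ℝ) else -1)] ∘ (Equiv.swap (0 : Fin 3) 2)) =
      ![(if (![!(ε 2), !(ε 1), !(ε 0)] : Fin 3 → Bool) 0 then (1 : ℝ) else -1) + (if (![!(ε 2), !(ε 1), !(ε 0)] : Fin 3 → Bool) 1 then (1 : ℝ) else -1),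
        -(if (![!(ε 2), !(ε 1), !(ε 0)] : Fin 3 → Bool) 0 then (1 : ℝ) else -1) + (if (![!(ε 2), !(ε 1), !(ε 0)] : Fin 3 → Bool) 2 then (1 : ℝ) else -1),
        -(if (![!(ε 2), !(ε 1), !(ε 0)] : Fin 3 → Bool) 1 then (1 : ℝ) else -1) - (if (![!(ε 2), !(ε 1), !(ε 0)] : Fin 3 → Bool) 2 then (1 : ℝ) else -1)] := by
  funext k
  fin_cases k <;> cases ε 0 <;> cases ε 1 <;> cases ε 2 <;> simp [Equiv.swap_apply_of_ne_of_ne] <;> norm_num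

/-- The relabelling `ε ↦ (¬ε₀, ε₂, ε₁)` is an involution of `Fin 3 → Bool`. [cite: Rogawski1990, §8.4 p. 126] -/
theorem involutive_relabel_zero_one : Function.Involutive (fun ε : Fin 3 → Bool => (![!(ε 0), ε 2, ε 1] : Fin 3 → Bool)) := by
  intro ε; funext i; fin_cases i <;> simp

/-- The relabelling `ε ↦ (ε₁, ε₀, ¬ε₂)` is an involution. [cite: Rogawski1990, §8.4 p. 126] -/
theorem involutive_relabel_one_two : Function.Involutive (fun ε : Fin 3 → Bool => (![ε 1, ε 0, !(ε 2)] : Fin 3 → Bool)) := by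
  intro ε; funext i; fin_cases i <;> simp

/-- The relabelling `ε ↦ (¬ε₂, ¬ε₁, ¬ε₀)` is an involution. [cite: Rogawski1990, §8.4 p. 126] -/
theorem involutive_relabel_zero_two : Function.Involutive (fun ε : Fin 3 → Bool => (![!(ε 2), !(ε 1), !(ε 0)] : Fin 3 → Bool)) := by
  intro ε; funext i; fin_cases i <;> simp

/-- **Reindexing step.**  If an involution `φ` of `Fin 3 → Bool` FLIPS the weight `s₀s₁s₂` and carries the relabelled rays, `u_ε ∘ τ = u_{φ ε}`, then
`Σ_ε s₀s₁s₂ · T_{u_ε∘τ} = −Σ_ε s₀s₁s₂ · T_{u_ε}` (reindex the finite sum by `φ`). [cite: Rogawski1990, §8.4 p. 126] -/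
theorem sum_weight_mul_reindex_neg (φ : (Fin 3 → Bool) → (Fin 3 → Bool)) (hφ : Function.Involutive φ)
    (hw : ∀ ε, (((if (φ ε) 0 then (1 : ℝ) else -1) * (if (φ ε) 1 then (1 : ℝ) else -1) * (if (φ ε) 2 then (1 : ℝ) else -1) : ℝ) : ℂ) =
      -(((if ε 0 then (1 : ℝ) else -1) * (if ε 1 then (1 : ℝ) else -1) * (if ε 2 then (1 : ℝ) else -1) : ℝ) : ℂ))
    (A B : (Fin 3 → Bool) → ℂ) (hAB : ∀ ε, A ε = B (φ ε)) :
    ∑ ε : Fin 3 → Bool, (((if ε 0 then (1 : ℝ) else -1) * (if ε 1 then (1 : ℝ) else -1) * (if ε 2 then (1 : ℝ) else -1) : ℝ) : ℂ) * A ε =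
      -∑ ε : Fin 3 → Bool, (((if ε 0 then (1 : ℝ) else -1) * (if ε 1 then (1 : ℝ) else -1) * (if ε 2 then (1 : ℝ) else -1) : ℝ) : ℂ) * B ε := by
  rw [← Finset.sum_neg_distrib]
  refine (Fintype.sum_equiv hφ.toPerm _ _ fun ε => ?_)
  -- term `ε` on the left equals term `φ ε` on the right
  show (((if ε 0 then (1 : ℝ) else -1) * (if ε 1 then (1 : ℝ) else -1) * (if ε 2 then (1 : ℝ) else -1) : ℝ) : ℂ) * A ε =
    -((((if (φ ε) 0 then (1 : ℝ) else -1) * (if (φ ε) 1 then (1 : ℝ) else -1) * (if (φ ε) 2 then (1 : ℝ) else -1) : ℝ) : ℂ) * B (φ ε))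
  rw [hw ε, hAB ε]
  ring

/-- **Transposition case**: for a line cube `T` with the transport rule, the 8-ray functional changes sign under each transposition. [cite: Rogawski1990, §8.4 p. 126] -/
theorem lambda8_comp_swap_of_rule (T : (Fin 3 → ℝ) → ((Fin 3 → X) → ℂ) → (Fin 3 → X) → ℂ)
    (hperm : ∀ (u : Fin 3 → ℝ) (G : (Fin 3 → X) → ℂ) (σ : Equiv.Perm (Fin 3)) (z : Fin 3 → X),
      T u (fun z' => G (z' ∘ σ)) z = T (u ∘ σ) G (z ∘ σ))
    (x y : Fin 3) (hxy : x ≠ y) (G : (Fin 3 → X) → ℂ) (z : Fin 3 → X) :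
    (1 / 48 : ℂ) * ∑ ε : Fin 3 → Bool, (((if ε 0 then (1 : ℝ) else -1) * (if ε 1 then (1 : ℝ) else -1) * (if ε 2 then (1 : ℝ) else -1) : ℝ) : ℂ) *
        T ![(if ε 0 then (1 : ℝ) else -1) + (if ε 1 then (1 : ℝ) else -1), -(if ε 0 then (1 : ℝ) else -1) + (if ε 2 then (1 : ℝ) else -1),
            -(if ε 1 then (1 : ℝ) else -1) - (if ε 2 then (1 : ℝ) else -1)] (fun z' => G (z' ∘ (Equiv.swap x y))) z =
      -((1 / 48 : ℂ) * ∑ ε : Fin 3 → Bool, (((if ε 0 then (1 : ℝ) else -1) * (if ε 1 then (1 : ℝ) else -1) * (if ε 2 then (1 : ℝ) else -1) : ℝ) : ℂ) *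
        T ![(if ε 0 then (1 : ℝ) else -1) + (if ε 1 then (1 : ℝ) else -1), -(if ε 0 then (1 : ℝ) else -1) + (if ε 2 then (1 : ℝ) else -1),
            -(if ε 1 then (1 : ℝ) else -1) - (if ε 2 then (1 : ℝ) else -1)] G (z ∘ (Equiv.swap x y))) := by
  simp only [hperm]
  rw [← mul_neg]
  congr 1
  -- the three transpositions, each via its involution
  have key : ∀ (a b : Fin 3), Equiv.swap x y = Equiv.swap a b →
      ((Equiv.swap a b = Equiv.swap (0 : Fin 3) 1) ∨ (Equiv.swap a b = Equiv.swap (1 : Fin 3) 2) ∨ (Equiv.swap a b = Equiv.swap (0 : Fin 3) 2)) →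
      ∑ ε : Fin 3 → Bool, (((if ε 0 then (1 : ℝ) else -1) * (if ε 1 then (1 : ℝ) else -1) * (if ε 2 then (1 : ℝ) else -1) : ℝ) : ℂ) *
          T (![(if ε 0 then (1 : ℝ) else -1) + (if ε 1 then (1 : ℝ) else -1), -(if ε 0 then (1 : ℝ) else -1) + (if ε 2 then (1 : ℝ) else -1),
              -(if ε 1 then (1 : ℝ) else -1) - (if ε 2 then (1 : ℝ) else -1)] ∘ (Equiv.swap x y)) G (z ∘ (Equiv.swap x y)) =
        -∑ ε : Fin 3 → Bool, (((if ε 0 then (1 : ℝ) else -1) * (if ε 1 then (1 : ℝ) else -1) * (if ε 2 then (1 : ℝ) else -1) : ℝ) : ℂ) *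
          T ![(if ε 0 then (1 : ℝ) else -1) + (if ε 1 then (1 : ℝ) else -1), -(if ε 0 then (1 : ℝ) else -1) + (if ε 2 then (1 : ℝ) else -1),
              -(if ε 1 then (1 : ℝ) else -1) - (if ε 2 then (1 : ℝ) else -1)] G (z ∘ (Equiv.swap x y)) := by
    intro a b hab hcases
    rw [hab]
    rcases hcases with h | h | h <;> rw [h]
    · refine sum_weight_mul_reindex_neg _ involutive_relabel_zero_one (fun ε => ?_) _ _ (fun ε => ?_)
      · cases ε 0 <;> cases ε 1 <;> cases ε 2 <;> simp
      · rw [signedRay_comp_swap_zero_one ε]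
    · refine sum_weight_mul_reindex_neg _ involutive_relabel_one_two (fun ε => ?_) _ _ (fun ε => ?_)
      · cases ε 0 <;> cases ε 1 <;> cases ε 2 <;> simp
      · rw [signedRay_comp_swap_one_two ε]
    · refine sum_weight_mul_reindex_neg _ involutive_relabel_zero_two (fun ε => ?_) _ _ (fun ε => ?_)
      · cases ε 0 <;> cases ε 1 <;> cases ε 2 <;> simp
      · rw [signedRay_comp_swap_zero_two ε]
  fin_cases x <;> fin_cases y
  · exact absurd rfl hxy
  · exact key 0 1 rfl (Or.inl rfl)
  · exact key 0 2 rfl (Or.inr (Or.inr rfl))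
  · exact key 0 1 (Equiv.swap_comm _ _) (Or.inl rfl)
  · exact absurd rfl hxy
  · exact key 1 2 rfl (Or.inr (Or.inl rfl))
  · exact key 0 2 (Equiv.swap_comm _ _) (Or.inr (Or.inr rfl))
  · exact key 1 2 (Equiv.swap_comm _ _) (Or.inr (Or.inl rfl))
  · exact absurd rfl hxy

/-- **`S₃`-ALTERNATION OF THE 8-RAY FUNCTIONAL (abstract form)**: with the transport rule alone, `Λ₈(G∘(·∘σ))(z) = sign σ · Λ₈G(z∘σ)` for every permutation `σ` — print's «`ω` is
skew-symmetric» for the letter's polarisation. [cite: Rogawski1990, §8.4 p. 126] -/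
theorem lambda8_comp_perm_of_rule (T : (Fin 3 → ℝ) → ((Fin 3 → X) → ℂ) → (Fin 3 → X) → ℂ)
    (hperm : ∀ (u : Fin 3 → ℝ) (G : (Fin 3 → X) → ℂ) (σ : Equiv.Perm (Fin 3)) (z : Fin 3 → X),
      T u (fun z' => G (z' ∘ σ)) z = T (u ∘ σ) G (z ∘ σ))
    (σ : Equiv.Perm (Fin 3)) (G : (Fin 3 → X) → ℂ) (z : Fin 3 → X) :
    (1 / 48 : ℂ) * ∑ ε : Fin 3 → Bool, (((if ε 0 then (1 : ℝ) else -1) * (if ε 1 then (1 : ℝ) else -1) * (if ε 2 then (1 : ℝ) else -1) : ℝ) : ℂ) *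
        T ![(if ε 0 then (1 : ℝ) else -1) + (if ε 1 then (1 : ℝ) else -1), -(if ε 0 then (1 : ℝ) else -1) + (if ε 2 then (1 : ℝ) else -1),
            -(if ε 1 then (1 : ℝ) else -1) - (if ε 2 then (1 : ℝ) else -1)] (fun z' => G (z' ∘ σ)) z =
      ((Equiv.Perm.sign σ : ℤ) : ℂ) *
        ((1 / 48 : ℂ) * ∑ ε : Fin 3 → Bool, (((if ε 0 then (1 : ℝ) else -1) * (if ε 1 then (1 : ℝ) else -1) * (if ε 2 then (1 : ℝ) else -1) : ℝ) : ℂ) *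
          T ![(if ε 0 then (1 : ℝ) else -1) + (if ε 1 then (1 : ℝ) else -1), -(if ε 0 then (1 : ℝ) else -1) + (if ε 2 then (1 : ℝ) else -1),
              -(if ε 1 then (1 : ℝ) else -1) - (if ε 2 then (1 : ℝ) else -1)] G (z ∘ σ)) := by
  induction σ using Equiv.Perm.swap_induction_on generalizing G z with
  | one => simp
  | swap_mul f x y hxy ih =>
      have hcomp : (fun z' : Fin 3 → X => G (z' ∘ ⇑(Equiv.swap x y * f))) = fun z' => (fun w : Fin 3 → X => G (w ∘ f)) (z' ∘ (Equiv.swap x y)) := by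
        funext z'; rfl
      rw [hcomp, lambda8_comp_swap_of_rule T hperm x y hxy (fun w : Fin 3 → X => G (w ∘ f)) z, ih G (z ∘ (Equiv.swap x y)),
        Equiv.Perm.sign_mul, Equiv.Perm.sign_swap hxy]
      push_cast
      simp only [Function.comp_assoc]
      ring

end Abstract

/-! ## §2 The genuine line cube: the 8-ray functional of the letter -/

section Circle

/-- **`S₃`-ALTERNATION OF THE LETTER'S 8-RAY FUNCTIONAL**: for EVERY `G : (S¹)³ → ℂ`, permutation `σ`, point `z`,
`Λ₈(G ∘ (·∘σ))(z) = sign σ · Λ₈G(z∘σ)`, `Λ₈G(z) = (1∕48)Σ_ε s₀s₁s₂ · iteratedDeriv 3 (s ↦ G(z·e^{isV_ε})) 0` — a syntactic identity of the inline tokens of ★ p842205 (no smoothness).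
[cite: Rogawski1990, §8.4 p. 126] -/
theorem lambda8_iteratedDeriv_comp_perm (σ : Equiv.Perm (Fin 3)) (G : (Fin 3 → Circle) → ℂ) (z : Fin 3 → Circle) :
    (1 / 48 : ℂ) * ∑ ε : Fin 3 → Bool, (((if ε 0 then (1 : ℝ) else -1) * (if ε 1 then (1 : ℝ) else -1) * (if ε 2 then (1 : ℝ) else -1) : ℝ) : ℂ) *
        iteratedDeriv 3 (fun s : ℝ => (fun z' : Fin 3 → Circle => G (z' ∘ σ))
          (fun k => z k * Circle.exp (s * ![(if ε 0 then (1 : ℝ) else -1) + (if ε 1 then (1 : ℝ) else -1), -(if ε 0 then (1 : ℝ) else -1) + (if ε 2 then (1 : ℝ) else -1),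
            -(if ε 1 then (1 : ℝ) else -1) - (if ε 2 then (1 : ℝ) else -1)] k))) 0 =
      ((Equiv.Perm.sign σ : ℤ) : ℂ) *
        ((1 / 48 : ℂ) * ∑ ε : Fin 3 → Bool, (((if ε 0 then (1 : ℝ) else -1) * (if ε 1 then (1 : ℝ) else -1) * (if ε 2 then (1 : ℝ) else -1) : ℝ) : ℂ) *
          iteratedDeriv 3 (fun s : ℝ => G
            (fun k => (z ∘ σ) k * Circle.exp (s * ![(if ε 0 then (1 : ℝ) else -1) + (if ε 1 then (1 : ℝ) else -1), -(if ε 0 then (1 : ℝ) else -1) + (if ε 2 then (1 : ℝ) else -1),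
              -(if ε 1 then (1 : ℝ) else -1) - (if ε 2 then (1 : ℝ) else -1)] k))) 0) :=
  lambda8_comp_perm_of_rule (X := Circle)
    (fun (u : Fin 3 → ℝ) (G : (Fin 3 → Circle) → ℂ) (z : Fin 3 → Circle) => iteratedDeriv 3 (fun s : ℝ => G (fun k => z k * Circle.exp (s * u k))) 0)
    (fun u G σ z => iteratedDeriv_ray_comp_perm 3 u G σ z) σ G z

/-- `Λ₈(c·G)(z) = c·Λ₈G(z)` (Mathlib `iteratedDeriv_const_mul_field`, no differentiability needed). [cite: Rogawski1990, §8.4 p. 126] -/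
theorem lambda8_iteratedDeriv_const_mul (c : ℂ) (G : (Fin 3 → Circle) → ℂ) (z : Fin 3 → Circle) :
    (1 / 48 : ℂ) * ∑ ε : Fin 3 → Bool, (((if ε 0 then (1 : ℝ) else -1) * (if ε 1 then (1 : ℝ) else -1) * (if ε 2 then (1 : ℝ) else -1) : ℝ) : ℂ) *
        iteratedDeriv 3 (fun s : ℝ => (fun z' : Fin 3 → Circle => c * G z')
          (fun k => z k * Circle.exp (s * ![(if ε 0 then (1 : ℝ) else -1) + (if ε 1 then (1 : ℝ) else -1), -(if ε 0 then (1 : ℝ) else -1) + (if ε 2 then (1 : ℝ) else -1),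
            -(if ε 1 then (1 : ℝ) else -1) - (if ε 2 then (1 : ℝ) else -1)] k))) 0 =
      c * ((1 / 48 : ℂ) * ∑ ε : Fin 3 → Bool, (((if ε 0 then (1 : ℝ) else -1) * (if ε 1 then (1 : ℝ) else -1) * (if ε 2 then (1 : ℝ) else -1) : ℝ) : ℂ) *
          iteratedDeriv 3 (fun s : ℝ => G
            (fun k => z k * Circle.exp (s * ![(if ε 0 then (1 : ℝ) else -1) + (if ε 1 then (1 : ℝ) else -1), -(if ε 0 then (1 : ℝ) else -1) + (if ε 2 then (1 : ℝ) else -1),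
              -(if ε 1 then (1 : ℝ) else -1) - (if ε 2 then (1 : ℝ) else -1)] k))) 0) := by
  simp only [iteratedDeriv_ray_const_mul]
  rw [Finset.mul_sum, Finset.mul_sum, Finset.mul_sum]
  refine Finset.sum_congr rfl fun ε _ => ?_
  ring

end Circle

/-! ## §3 The collapse lemma in the letter's 8-ray shape -/

section Collapse

/-- **THE COLLAPSE LEMMA (8-ray, exact form)**: `Λ₈[z′ ↦ ρ′Δ(z′)·Φ(z′∘σ)](z) = Λ₈[ρ′Δ·Φ](z∘σ)` at every `z`, with `ρ′Δ` the letter's inline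
`↑z′₀(↑z′₂)⁻¹·((1−↑z′₁(↑z′₀)⁻¹)(1−↑z′₂(↑z′₁)⁻¹)(1−↑z′₂(↑z′₀)⁻¹))` (★ `rhoWeylDelta_comp_perm`: exactly skew; `(sign σ)² = 1`). [cite: Rogawski1990, §8.4 p. 126] -/
theorem lambda8_rhoWeylDelta_mul_comp_perm (Φ : (Fin 3 → Circle) → ℂ) (σ : Equiv.Perm (Fin 3)) (z : Fin 3 → Circle) :
    (1 / 48 : ℂ) * ∑ ε : Fin 3 → Bool, (((if ε 0 then (1 : ℝ) else -1) * (if ε 1 then (1 : ℝ) else -1) * (if ε 2 then (1 : ℝ) else -1) : ℝ) : ℂ) *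
        iteratedDeriv 3 (fun s : ℝ => (fun z' : Fin 3 → Circle =>
            ((z' 0 : ℂ) * ((z' 2 : ℂ))⁻¹ * ((1 - (z' 1 : ℂ) * ((z' 0 : ℂ))⁻¹) * (1 - (z' 2 : ℂ) * ((z' 1 : ℂ))⁻¹) * (1 - (z' 2 : ℂ) * ((z' 0 : ℂ))⁻¹))) * Φ (z' ∘ σ))
          (fun k => z k * Circle.exp (s * ![(if ε 0 then (1 : ℝ) else -1) + (if ε 1 then (1 : ℝ) else -1), -(if ε 0 then (1 : ℝ) else -1) + (if ε 2 then (1 : ℝ) else -1),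
            -(if ε 1 then (1 : ℝ) else -1) - (if ε 2 then (1 : ℝ) else -1)] k))) 0 =
      (1 / 48 : ℂ) * ∑ ε : Fin 3 → Bool, (((if ε 0 then (1 : ℝ) else -1) * (if ε 1 then (1 : ℝ) else -1) * (if ε 2 then (1 : ℝ) else -1) : ℝ) : ℂ) *
        iteratedDeriv 3 (fun s : ℝ => (fun z' : Fin 3 → Circle =>
            ((z' 0 : ℂ) * ((z' 2 : ℂ))⁻¹ * ((1 - (z' 1 : ℂ) * ((z' 0 : ℂ))⁻¹) * (1 - (z' 2 : ℂ) * ((z' 1 : ℂ))⁻¹) * (1 - (z' 2 : ℂ) * ((z' 0 : ℂ))⁻¹))) * Φ z')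
          (fun k => (z ∘ σ) k * Circle.exp (s * ![(if ε 0 then (1 : ℝ) else -1) + (if ε 1 then (1 : ℝ) else -1), -(if ε 0 then (1 : ℝ) else -1) + (if ε 2 then (1 : ℝ) else -1),
            -(if ε 1 then (1 : ℝ) else -1) - (if ε 2 then (1 : ℝ) else -1)] k))) 0 := by
  have hskew : ∀ z' : Fin 3 → Circle,
      ((z' 0 : ℂ) * ((z' 2 : ℂ))⁻¹ * ((1 - (z' 1 : ℂ) * ((z' 0 : ℂ))⁻¹) * (1 - (z' 2 : ℂ) * ((z' 1 : ℂ))⁻¹) * (1 - (z' 2 : ℂ) * ((z' 0 : ℂ))⁻¹))) * Φ (z' ∘ σ) =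
        ((Equiv.Perm.sign σ : ℤ) : ℂ) *
          (fun w : Fin 3 → Circle => ((w 0 : ℂ) * ((w 2 : ℂ))⁻¹ * ((1 - (w 1 : ℂ) * ((w 0 : ℂ))⁻¹) * (1 - (w 2 : ℂ) * ((w 1 : ℂ))⁻¹) * (1 - (w 2 : ℂ) * ((w 0 : ℂ))⁻¹))) * Φ w)
            (z' ∘ σ) := by
    intro z'
    have h := rhoWeylDelta_comp_perm σ (fun k => (z' k : ℂ)) (fun k => Circle.coe_ne_zero (z' k))
    simp only [Function.comp_apply] at h ⊢
    rw [h]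
    simp only [← mul_assoc, sign_cast_mul_self, one_mul]
  have hfun : (fun z' : Fin 3 → Circle =>
      ((z' 0 : ℂ) * ((z' 2 : ℂ))⁻¹ * ((1 - (z' 1 : ℂ) * ((z' 0 : ℂ))⁻¹) * (1 - (z' 2 : ℂ) * ((z' 1 : ℂ))⁻¹) * (1 - (z' 2 : ℂ) * ((z' 0 : ℂ))⁻¹))) * Φ (z' ∘ σ)) =
      fun z' : Fin 3 → Circle => ((Equiv.Perm.sign σ : ℤ) : ℂ) *
        (fun w : Fin 3 → Circle => ((w 0 : ℂ) * ((w 2 : ℂ))⁻¹ * ((1 - (w 1 : ℂ) * ((w 0 : ℂ))⁻¹) * (1 - (w 2 : ℂ) * ((w 1 : ℂ))⁻¹) * (1 - (w 2 : ℂ) * ((w 0 : ℂ))⁻¹))) * Φ w)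
          (z' ∘ σ) := funext hskew
  rw [hfun, lambda8_iteratedDeriv_const_mul ((Equiv.Perm.sign σ : ℤ) : ℂ)
      (fun z' : Fin 3 → Circle => (fun w : Fin 3 → Circle => ((w 0 : ℂ) * ((w 2 : ℂ))⁻¹ * ((1 - (w 1 : ℂ) * ((w 0 : ℂ))⁻¹) * (1 - (w 2 : ℂ) * ((w 1 : ℂ))⁻¹) * (1 - (w 2 : ℂ) * ((w 0 : ℂ))⁻¹))) * Φ w) (z' ∘ σ)) z,
    lambda8_iteratedDeriv_comp_perm σ
      (fun w : Fin 3 → Circle => ((w 0 : ℂ) * ((w 2 : ℂ))⁻¹ * ((1 - (w 1 : ℂ) * ((w 0 : ℂ))⁻¹) * (1 - (w 2 : ℂ) * ((w 1 : ℂ))⁻¹) * (1 - (w 2 : ℂ) * ((w 0 : ℂ))⁻¹))) * Φ w) z,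
    ← mul_assoc, sign_cast_mul_self, one_mul]

/-- **THE COLLAPSE LEMMA (8-ray, limit form)** — the letter's shape: if `Λ₈[ρ′Δ·Φ](z) → ℓ` as `z → (ζ,ζ,ζ)` through regular `z`, then `Λ₈[z′ ↦ ρ′Δ(z′)·Φ(z′∘σ)](z) → ℓ` along the same
filter — each class `diag(z∘σ)` of the (unsigned, (14.2.1)) stable class of `diag z` contributes the SAME `−(c·I)·Θ(ζ•1)`, so `ω[ρΔΦ^{st}](γ₀) = Card · (−c·I)·f(γ₀)` (`3c_G` on `U(2,1)`,
p. 126). [cite: Rogawski1990, §8.4 p. 126] -/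
theorem tendsto_lambda8_rhoWeylDelta_mul_comp_perm (Φ : (Fin 3 → Circle) → ℂ) (σ : Equiv.Perm (Fin 3)) {ζ : Circle} {ℓ : ℂ}
    (h : Tendsto (fun z : Fin 3 → Circle =>
      (1 / 48 : ℂ) * ∑ ε : Fin 3 → Bool, (((if ε 0 then (1 : ℝ) else -1) * (if ε 1 then (1 : ℝ) else -1) * (if ε 2 then (1 : ℝ) else -1) : ℝ) : ℂ) *
        iteratedDeriv 3 (fun s : ℝ => (fun z' : Fin 3 → Circle =>
            ((z' 0 : ℂ) * ((z' 2 : ℂ))⁻¹ * ((1 - (z' 1 : ℂ) * ((z' 0 : ℂ))⁻¹) * (1 - (z' 2 : ℂ) * ((z' 1 : ℂ))⁻¹) * (1 - (z' 2 : ℂ) * ((z' 0 : ℂ))⁻¹))) * Φ z')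
          (fun k => z k * Circle.exp (s * ![(if ε 0 then (1 : ℝ) else -1) + (if ε 1 then (1 : ℝ) else -1), -(if ε 0 then (1 : ℝ) else -1) + (if ε 2 then (1 : ℝ) else -1),
            -(if ε 1 then (1 : ℝ) else -1) - (if ε 2 then (1 : ℝ) else -1)] k))) 0)
      (𝓝[{z : Fin 3 → Circle | Function.Injective z}] (fun _ => ζ)) (𝓝 ℓ)) :
    Tendsto (fun z : Fin 3 → Circle =>
      (1 / 48 : ℂ) * ∑ ε : Fin 3 → Bool, (((if ε 0 then (1 : ℝ) else -1) * (if ε 1 then (1 : ℝ) else -1) * (if ε 2 then (1 : ℝ) else -1) : ℝ) : ℂ) *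
        iteratedDeriv 3 (fun s : ℝ => (fun z' : Fin 3 → Circle =>
            ((z' 0 : ℂ) * ((z' 2 : ℂ))⁻¹ * ((1 - (z' 1 : ℂ) * ((z' 0 : ℂ))⁻¹) * (1 - (z' 2 : ℂ) * ((z' 1 : ℂ))⁻¹) * (1 - (z' 2 : ℂ) * ((z' 0 : ℂ))⁻¹))) * Φ (z' ∘ σ))
          (fun k => z k * Circle.exp (s * ![(if ε 0 then (1 : ℝ) else -1) + (if ε 1 then (1 : ℝ) else -1), -(if ε 0 then (1 : ℝ) else -1) + (if ε 2 then (1 : ℝ) else -1),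
            -(if ε 1 then (1 : ℝ) else -1) - (if ε 2 then (1 : ℝ) else -1)] k))) 0)
      (𝓝[{z : Fin 3 → Circle | Function.Injective z}] (fun _ => ζ)) (𝓝 ℓ) := by
  simp only [lambda8_rhoWeylDelta_mul_comp_perm Φ σ]
  exact h.comp (tendsto_comp_perm_nhdsWithin_injective σ ζ)

end Collapse

end Literature.NumberTheory.Rogawski1990

end
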